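import Mathlib
import Summits.MatrixMultiplication.MatrixMultiplication.Theorems.SoloBlindKFlatCorankFour
import Summits.MatrixMultiplication.MatrixMultiplication.Theorems.SoloBlindFlatCertFourEA
import Summits.MatrixMultiplication.MatrixMultiplication.Theorems.SoloBlindFlatCertFourEB
import Summits.MatrixMultiplication.MatrixMultiplication.Theorems.SoloBlindFlatCertFourEC
import Summits.MatrixMultiplication.MatrixMultiplication.Theorems.SoloBlindFlatCertFourED
import Summits.MatrixMultiplication.MatrixMultiplication.Theorems.SoloBlindFlatCertFourEE
import Summits.MatrixMultiplication.MatrixMultiplication.Theorems.SoloBlindFlatCertFourEF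
import Summits.MatrixMultiplication.MatrixMultiplication.Theorems.SoloBlindFlatCertFourEG
import Summits.MatrixMultiplication.MatrixMultiplication.Theorems.SoloBlindFlatCertFourEH
import Summits.MatrixMultiplication.MatrixMultiplication.Theorems.SoloBlindFlatCertFourEI
import Summits.MatrixMultiplication.MatrixMultiplication.Theorems.SoloBlindFlatCertFourEJ
import Summits.MatrixMultiplication.MatrixMultiplication.Theorems.SoloBlindFlatCertFourEK
import Summits.MatrixMultiplication.MatrixMultiplication.Theorems.SoloBlindFlatCertFourEL

/-!
# Conjecture E♭ at corank at most four, every rank (certified)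

The mode-E flat certificate up to four letters at scale `56` (`m ≤ 3` from `SoloBlindFlatCertThree`,
`m = 4` in twenty-three chunks), hence by `soloBlind_eflat_of_certifiedE`: in a `ZMod 3`-module, for
`h` zero-sum free on `S` with `|S| ≤ dim span h(S) + 4` and every `H`-good target `τ` (no sub-sum
equals `2τ`), CONJECTURE E♭ holds: `K(τ; S) ≤ 1/2 + 2^{-ρ} - 2^{ρ-1-c}` (`ρ` the rank, `c` the size
of the core of `τ`).  This refines the certified `E ≤ 1/2` at corank at most four
(`soloBlind_conjE_rank_add_four`), and with `soloBlind_kflat_rank_add_four` gives the two-mode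
certificate `soloBlindFlatCertified 4 56`.  Computational (downstream of `native_decide`).
-/

namespace Summit.MatrixMultiplication.MatrixMultiplication.Theorems

/-- The twenty-three chunks of the four-letter mode-E certificate. -/
theorem soloBlind_flatCert_four_E : ∀ i < 23, soloBlindFlatCertCanon 4 23 i 56 true = true := by
  intro i hi
  interval_cases i
  exacts [soloBlind_flatCert_four_E_0, soloBlind_flatCert_four_E_1, soloBlind_flatCert_four_E_2, soloBlind_flatCert_four_E_3,
    soloBlind_flatCert_four_E_4, soloBlind_flatCert_four_E_5, soloBlind_flatCert_four_E_6, soloBlind_flatCert_four_E_7,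
    soloBlind_flatCert_four_E_8, soloBlind_flatCert_four_E_9, soloBlind_flatCert_four_E_10, soloBlind_flatCert_four_E_11,
    soloBlind_flatCert_four_E_12, soloBlind_flatCert_four_E_13, soloBlind_flatCert_four_E_14, soloBlind_flatCert_four_E_15,
    soloBlind_flatCert_four_E_16, soloBlind_flatCert_four_E_17, soloBlind_flatCert_four_E_18, soloBlind_flatCert_four_E_19,
    soloBlind_flatCert_four_E_20, soloBlind_flatCert_four_E_21, soloBlind_flatCert_four_E_22]

/-- THE MODE-E FLAT CERTIFICATE UP TO FOUR LETTERS at scale `56`. -/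
theorem soloBlind_flatCertifiedE_four : soloBlindFlatCertifiedMode 4 56 true := by
  intro m hm
  rcases Nat.lt_or_ge m 4 with hlt | hge
  · exact soloBlind_flatCertifiedMode_of soloBlind_flatCertified_three true m (by omega)
  · obtain rfl : m = 4 := le_antisymm hm hge
    exact ⟨23, by norm_num, soloBlind_flatCert_four_E⟩

/-- THE TWO-MODE FLAT CERTIFICATE UP TO FOUR LETTERS at scale `56`. -/
theorem soloBlind_flatCertified_four : soloBlindFlatCertified 4 56 := by
  intro m hm modeE
  cases modeE
  · exact soloBlind_flatCertifiedK_four m hm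
  · exact soloBlind_flatCertifiedE_four m hm

variable {G : Type*} [AddCommGroup G] [DecidableEq G] [Module (ZMod 3) G] {ι : Type*} [DecidableEq ι]

/-- CONJECTURE E♭ AT CORANK AT MOST FOUR, EVERY RANK: `h` zero-sum free on `S` with
`|S| ≤ dim span h(S) + 4` and `τ` `H`-good ⟹ `K(τ; S) ≤ 1/2 + 2^{-ρ} - 2^{ρ-1-c}`. -/
theorem soloBlind_eflat_rank_add_four {h : ι → G} {S : Finset ι}
    (hc : S.card ≤ Module.finrank (ZMod 3) (Submodule.span (ZMod 3) (h '' (↑S : Set ι))) + 4)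
    (zsf : ∀ T ⊆ S, T.Nonempty → ∑ i ∈ T, h i ≠ 0) {τ : G} (hgood : ∀ T ⊆ S, ∑ i ∈ T, h i ≠ τ + τ) :
    soloBlindEFlatAt h S τ :=
  soloBlind_eflat_of_certifiedE soloBlind_flatCertifiedE_four (by norm_num) hc zsf hgood

end Summit.MatrixMultiplication.MatrixMultiplication.Theorems
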